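import Summits.SmoothPoincare4.SmoothPoincare4.Theorems.ConvexBisectionAcyclicBisectionExistsStabBlockMapTube
import Summits.SmoothPoincare4.SmoothPoincare4.Theorems.ConvexBisectionAcyclicBisectionExistsBaseReflectionTwisting
import Mathlib.Analysis.SpecialFunctions.SmoothTransition
import HarnessLib

/-!
# N3 (`stub_STgeo`) ▸ N3-nat ▸ N3d-1 ▸ N3c: THE BLOCK ATTACHING MAP ALONG AN EMBEDDED PAGE CURVE —
# page twisting `−1`, the globally smooth fibred tube, and the assembly of clauses
# `qA_circle ∧ qA_twist ∧ qA_tube` (and `range ⊆ U`) of `StabBaseData`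
(wave 7, brick H6-4 of stub `stub_STgeo` = node N3 of NF4, line `modp-braid-orbits`, crux
`ConvexBisection.AcyclicBisectionExists`, item stmt-SmoothPoincare4-10508; registered sub-goal
`helper_exists_blockMap`; design file `work/design/N3_Stabilisation_Design.lean` (G5, wave 6), N3c
"the maps `qA qB` by TUBE with a framing of prescribed page twisting `−1`"; vocabulary
`…StabilisationData.lean` (H6-1); the tube map `…StabBlockMapTube.lean` (H6-3).)

For a smoothly embedded curve `A` in a flat page `page g d` of the base and any open `U ⊇ A(𝕊¹)`:
**there is a Lefschetz attaching map `qA` along `A` — range in `U`, attaching circle `A`, PAGE TWISTING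
`−1` (a positive Lefschetz handle), which IS the once-twisted standard tube map of a globally smooth
fibred tube `Φ` around `A`** (`exists_blockMap`; the last three conclusions are VERBATIM the clauses
`qA_circle`, `qA_twist`, `qA_tube` of `StabBaseData` read at `(g, d)` instead of
`(g + 1, pageDir (n+4) 0)`, with `s = true`, `σ = κ₀` the rate of Z4's page tube).

* §1 a smooth radial SQUASH `ℝ² → B(0,1)` equal to the identity on `B̄(0, ½)` (`exists_squash`:
  `v ↦ (1 + ‖v‖² χ(4‖v‖² − 1))^{-1/2} v`, `χ = Real.smoothTransition`), turning Z4's page tube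
  (`helper_exists_pageTube`: a `CircleTube` smooth on the unit tube only) into a GLOBALLY smooth
  `Φ : 𝕊¹ × ℝ² → Base g`, unchanged — hence fibred over the pages and injective — on `𝕊¹ × B(0, ½)`;
* §2 scaling a framing by a non-zero constant keeps the page twisting (`pageTwisting_smul`; linearity of
  `ambient` is the landed `ambient_smul` of `…PageTwistingTransverseLoop`);
* §3 **the page twisting of the block map is `−1`** (`pageTwisting_blockMap_eq_neg_one`): its handle
  framing is `κ ·` the one-twist fibre framing `d/dε|₀ Φ₀ (θ, ε reflFibre (−1) θ)` of Z4's tube (H6-3 +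
  the chain rule), whose page twisting Y2 computed (`pageTwisting_core`, slide direction `false`, sign
  `s = −1`: `= s · σ_false = −1`);
* §4 assembly `exists_blockMap` / registered `helper_exists_blockMap`.

Everything is proved; no definitions, no named facts.  References: J. B. Etnyre, T. Fuller, IMRN 2006,
§2 ("framing one less than the framing induced by `Σ`") [EtnyreFuller2006]; A. A. Kosinski,
*Differential Manifolds* (1993), III (3.1), VI §6 [Kosinski1993].
-/

noncomputable section

-- the prescribed namespace `Summit.<P>.<Sub>.…` duplicates `SmoothPoincare4` (P = Sub)
set_option linter.dupNamespace false

open scoped Manifold ContDiff Topology Real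
open Set Function Metric

namespace Summit.SmoothPoincare4.SmoothPoincare4.Theorems.AcyclicBisectionExists.ModpBraidOrbits

open Literature.Topology.FourManifolds Literature.Topology.FourManifolds.LefschetzBase
open Literature.Topology.FourManifolds.HandleAttachingMap
open Literature.Geometry.Symplectic Literature.Topology.PlaneTopology

namespace StabBlockMap

variable {g : ℕ}

/-! ## §1 The squash and the globally smooth fibred tube -/

/-- **A smooth radial squash of `ℝ²` into the open unit disc, the identity on `‖v‖ ≤ ½`**:
`v ↦ (1 + ‖v‖² χ(4‖v‖² − 1))^{-1/2} v` with `χ = Real.smoothTransition`. [folklore] -/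
theorem exists_squash : ∃ sq : EuclideanSpace ℝ (Fin 2) → EuclideanSpace ℝ (Fin 2),
    ContDiff ℝ ∞ sq ∧ (∀ v, ‖v‖ ≤ 1 / 2 → sq v = v) ∧ ∀ v, ‖sq v‖ < 1 := by
  set f : EuclideanSpace ℝ (Fin 2) → ℝ := fun v =>
    1 + ‖v‖ ^ 2 * Real.smoothTransition (4 * ‖v‖ ^ 2 - 1) with hf
  have hf1 : ∀ v, 1 ≤ f v := fun v => by
    have := mul_nonneg (sq_nonneg ‖v‖) (Real.smoothTransition.nonneg (4 * ‖v‖ ^ 2 - 1))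
    simp only [hf]; linarith
  have hfpos : ∀ v, 0 < f v := fun v => lt_of_lt_of_le one_pos (hf1 v)
  have hfs : ContDiff ℝ ∞ f := by
    have hn : ContDiff ℝ ∞ fun v : EuclideanSpace ℝ (Fin 2) => ‖v‖ ^ 2 := contDiff_norm_sq ℝ
    exact contDiff_const.add (hn.mul (Real.smoothTransition.contDiff.comp
      ((contDiff_const.mul hn).sub contDiff_const)))
  refine ⟨fun v => Real.sqrt (f v)⁻¹ • v, ?_, fun v hv => ?_, fun v => ?_⟩
  · exact ((hfs.inv fun v => (hfpos v).ne').sqrt fun v => (inv_pos.2 (hfpos v)).ne').smul contDiff_id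
  · have h0 : 4 * ‖v‖ ^ 2 - 1 ≤ 0 := by nlinarith [norm_nonneg v]
    have : f v = 1 := by simp only [hf, Real.smoothTransition.zero_of_nonpos h0]; ring
    simp [this]
  · rw [norm_smul, Real.norm_eq_abs, abs_of_nonneg (Real.sqrt_nonneg _)]
    have hlt : ‖v‖ ^ 2 < f v := by
      rcases lt_or_ge (‖v‖ ^ 2) 1 with h | h
      · exact h.trans_le (hf1 v)
      · have h1 : 1 ≤ 4 * ‖v‖ ^ 2 - 1 := by linarith
        simp only [hf, Real.smoothTransition.one_of_one_le h1]; linarith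
    have hsq : (Real.sqrt (f v)⁻¹ * ‖v‖) ^ 2 < 1 := by
      rw [mul_pow, Real.sq_sqrt (inv_pos.2 (hfpos v)).le, inv_mul_lt_iff₀ (hfpos v)]
      linarith
    have hnn : 0 ≤ Real.sqrt (f v)⁻¹ * ‖v‖ := mul_nonneg (Real.sqrt_nonneg _) (norm_nonneg _)
    nlinarith

/-- **The globally smooth fibred tube of a circle tube**: `Φ (x, v) := Φ₀ (x, sq v)` is smooth on all of
`𝕊¹ × ℝ²`, injective on `𝕊¹ × B(0, ½)`, and equal to `Φ₀` there. [cite: Kosinski1993, III (3.1)] -/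
theorem exists_global_tube (Φ₀ : CircleTube (bBase g).carrier) :
    ∃ Φ : sphere (0 : EuclideanSpace ℝ (Fin 2)) 1 × EuclideanSpace ℝ (Fin 2) → Base g,
      ContMDiff ((𝓡 1).prod (𝓡 2)) (𝓡∂ 4) ∞ Φ ∧
      InjOn Φ (univ ×ˢ ball (0 : EuclideanSpace ℝ (Fin 2)) (1 / 2)) ∧
      ∀ x v, ‖v‖ ≤ 1 / 2 → Φ (x, v) = (bBase g).incl (Φ₀.toHomeo (x, v)) := by
  obtain ⟨sq, hsq, hid, hlt⟩ := exists_squash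
  have hmem : ∀ p : sphere (0 : EuclideanSpace ℝ (Fin 2)) 1 × EuclideanSpace ℝ (Fin 2),
      (p.1, sq p.2) ∈ Φ₀.toHomeo.source := fun p => Φ₀.mem_source_iff.2 (hlt p.2)
  refine ⟨fun p => (bBase g).incl (Φ₀.toHomeo (p.1, sq p.2)), ?_, ?_, fun x v hv => by simp [hid v hv]⟩
  · refine (bBase g).isSmoothEmbedding.contMDiff.comp (Φ₀.contMDiffOn_toHomeo.comp_contMDiff ?_ hmem)
    exact contMDiff_fst.prodMk ((hsq.contMDiff).comp contMDiff_snd)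
  · rintro ⟨x, v⟩ ⟨-, hv⟩ ⟨x', v'⟩ ⟨-, hv'⟩ h
    rw [mem_ball_zero_iff] at hv hv'
    have h1 := Φ₀.toHomeo.injOn (hmem (x, v)) (hmem (x', v')) ((bBase g).injective_incl h)
    simp only [hid v hv.le, hid v' hv'.le] at h1
    exact h1

/-! ## §2 Scaling a framing keeps the page twisting -/

/-- The twisting loop of a scaled framing is the scaled twisting loop (`ambient_smul`, X-wave
`…PageTwistingTransverseLoop`). [folklore] -/
theorem pageTwistingLoop_smul (K : sphere (0 : EuclideanSpace ℝ (Fin 2)) 1 → Base g)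
    (ν : sphere (0 : EuclideanSpace ℝ (Fin 2)) 1 → EuclideanSpace ℝ (Fin 4)) (c t : ℝ) :
    pageTwistingLoop g K (fun θ => c • ν θ) t = (c : ℂ) * pageTwistingLoop g K ν t := by
  apply Complex.ext <;> simp [pageTwistingLoop, ambient_smul, real_inner_smul_left]

/-- **Scaling a framing by a non-zero constant does not change its page twisting** (winding number
of `c ·` a non-vanishing loop). [folklore] -/
theorem pageTwisting_smul {K : sphere (0 : EuclideanSpace ℝ (Fin 2)) 1 → Base g}
    {ν : sphere (0 : EuclideanSpace ℝ (Fin 2)) 1 → EuclideanSpace ℝ (Fin 4)} {c : ℝ} (hc : c ≠ 0)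
    (hloop : IsNonvanishingLoop (pageTwistingLoop g K ν)) :
    pageTwisting g K (fun θ => c • ν θ) = pageTwisting g K ν := by
  unfold pageTwisting
  rw [show pageTwistingLoop g K (fun θ => c • ν θ) = fun t => (c : ℂ) * pageTwistingLoop g K ν t from
    funext (pageTwistingLoop_smul K ν c)]
  rw [wind_mul (IsNonvanishingLoop.const (by exact_mod_cast hc)) hloop, wind_const, zero_add]

/-! ## §3 The page twisting of the block map is `−1` -/

/-- The one-twist fibre curve `ε ↦ Φ₀ (θ, ε · reflFibre (−1) θ)` through the core is smooth at `ε = 0`.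
[folklore] -/
theorem contMDiffAt_fibreCurve (Φ₀ : CircleTube (bBase g).carrier) (θ : sphere (0 : EuclideanSpace ℝ (Fin 2)) 1) :
    ContMDiffAt 𝓘(ℝ, ℝ) (𝓡∂ 4) ∞ (fun ε : ℝ => (bBase g).incl (Φ₀.toHomeo
      (θ, ε • reflFibre (-1) (θ : EuclideanSpace ℝ (Fin 2))))) 0 := by
  have hΦ : ContMDiffAt ((𝓡 1).prod 𝓘(ℝ, EuclideanSpace ℝ (Fin 2))) (𝓡 3) ∞ Φ₀.toHomeo
      ((fun ε : ℝ => ((θ, ε • reflFibre (-1) (θ : EuclideanSpace ℝ (Fin 2))) :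
        sphere (0 : EuclideanSpace ℝ (Fin 2)) 1 × EuclideanSpace ℝ (Fin 2))) 0) := by
    simp only [zero_smul]
    exact Φ₀.contMDiffAt_toHomeo (Φ₀.mem_source_zero θ)
  have hc : ContMDiffAt 𝓘(ℝ, ℝ) ((𝓡 1).prod 𝓘(ℝ, EuclideanSpace ℝ (Fin 2))) ∞
      (fun ε : ℝ => ((θ, ε • reflFibre (-1) (θ : EuclideanSpace ℝ (Fin 2))) :
        sphere (0 : EuclideanSpace ℝ (Fin 2)) 1 × EuclideanSpace ℝ (Fin 2))) 0 :=
    contMDiffAt_const.prodMk ((contDiff_id.smul contDiff_const).contMDiff.contMDiffAt)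
  exact (bBase g).isSmoothEmbedding.contMDiff.contMDiffAt.comp 0 (hΦ.comp 0 hc)

/-- **Chain rule for the handle framing of the block map**: `d/ds|₀ Φ₀ (θ, κ sin s · reflFibre (−1) θ) =
κ · d/dε|₀ Φ₀ (θ, ε · reflFibre (−1) θ)`. [folklore] -/
theorem mfderiv_blockFraming_eq_smul (Φ₀ : CircleTube (bBase g).carrier) (κ : ℝ)
    (θ : sphere (0 : EuclideanSpace ℝ (Fin 2)) 1) :
    mfderiv 𝓘(ℝ, ℝ) (𝓡∂ 4) (fun s : ℝ => (bBase g).incl (Φ₀.toHomeo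
        (θ, (κ * Real.sin s) • reflFibre (-1) (θ : EuclideanSpace ℝ (Fin 2))))) 0 (1 : ℝ) =
      κ • mfderiv 𝓘(ℝ, ℝ) (𝓡∂ 4) (fun ε : ℝ => (bBase g).incl (Φ₀.toHomeo
        (θ, ε • reflFibre (-1) (θ : EuclideanSpace ℝ (Fin 2))))) 0 (1 : ℝ) := by
  set G : ℝ → Base g := fun ε => (bBase g).incl (Φ₀.toHomeo
    (θ, ε • reflFibre (-1) (θ : EuclideanSpace ℝ (Fin 2)))) with hG
  set f : ℝ → ℝ := fun s => κ * Real.sin s with hf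
  have hf0 : f 0 = 0 := by simp [hf]
  have hrd : HasMFDerivAt 𝓘(ℝ, ℝ) 𝓘(ℝ, ℝ) f 0 (ContinuousLinearMap.smulRight (1 : ℝ →L[ℝ] ℝ) κ) := by
    have h := ((Real.hasDerivAt_sin 0).const_mul κ).hasFDerivAt.hasMFDerivAt
    simp only [Real.cos_zero, mul_one] at h
    exact h
  have hGd : MDifferentiableAt 𝓘(ℝ, ℝ) (𝓡∂ 4) G 0 :=
    (contMDiffAt_fibreCurve Φ₀ θ).mdifferentiableAt (by simp)
  have hG' : HasMFDerivAt 𝓘(ℝ, ℝ) (𝓡∂ 4) G (f 0) (mfderiv 𝓘(ℝ, ℝ) (𝓡∂ 4) G 0) := by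
    rw [hf0]; exact hGd.hasMFDerivAt
  have hcomp := hG'.comp 0 hrd
  have hfun : (fun s : ℝ => (bBase g).incl (Φ₀.toHomeo
      (θ, (κ * Real.sin s) • reflFibre (-1) (θ : EuclideanSpace ℝ (Fin 2))))) = G ∘ f := rfl
  rw [hfun, hcomp.mfderiv]
  show (mfderiv 𝓘(ℝ, ℝ) (𝓡∂ 4) G 0) ((ContinuousLinearMap.smulRight (1 : ℝ →L[ℝ] ℝ) κ) (1 : ℝ)) =
    κ • mfderiv 𝓘(ℝ, ℝ) (𝓡∂ 4) G 0 (1 : ℝ)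
  have e : (ContinuousLinearMap.smulRight (1 : ℝ →L[ℝ] ℝ) κ) (1 : ℝ) = κ • (1 : ℝ) := by simp
  rw [e]
  exact (mfderiv 𝓘(ℝ, ℝ) (𝓡∂ 4) G 0).map_smul κ 1

/-- **The page twisting of the block map is `−1`.**  For Z4's page tube `Φ₀` around the smoothly
embedded page curve `A` (CORE and FIBRE-DERIVATIVE clauses of `helper_exists_pageTube`) and an attaching
map `q` with attaching circle `A` whose handle framing is `d/ds|₀ Φ₀ (θ, κ sin s · reflFibre (−1) θ)`,
`κ ≠ 0` (the export of `…StabBlockMapTube.lean`): `pageTwisting g A q.attachingFraming = −1` — the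
framing is `κ ·` the one-twist fibre framing of sign `−1`, of page twisting `−1 · σ_false = −1` by Y2's
`pageTwisting_core`. [cite: EtnyreFuller2006, §2] -/
theorem pageTwisting_blockMap_eq_neg_one {d : ℂ} (hd : ‖d‖ = 1)
    {A : sphere (0 : EuclideanSpace ℝ (Fin 2)) 1 → Base g} (hA : Manifold.IsSmoothEmbedding (𝓡 1) (𝓡∂ 4) ∞ A)
    (hAd : ∀ θ, A θ ∈ page g d) (Φ₀ : CircleTube (bBase g).carrier) {κ₀ r : ℝ} (hκ₀ : 0 < κ₀) (hr : 0 < r)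
    (hcore : ∀ ψ, (bBase g).incl (Φ₀.core ψ) = A ψ)
    (hder : ∀ t : ℝ, HasFDerivAt (fun v : EuclideanSpace ℝ (Fin 2) =>
        ((bBase g).incl (Φ₀.toHomeo (circlePt t, v))).1)
      ((EuclideanSpace.proj (𝕜 := ℝ) (0 : Fin 2)).smulRight (r • cplxJ (deriv (ambCurve g A) t)) +
        (EuclideanSpace.proj (𝕜 := ℝ) (1 : Fin 2)).smulRight (κ₀ • rotField g (A (circlePt t)).1)) 0)
    (q : HandleAttachingMap 3 2 (Base g)) {κ : ℝ} (hκ : κ ≠ 0) (hcirc : q.attachingCircle = A)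
    (hfr : ∀ θ : sphere (0 : EuclideanSpace ℝ (Fin 2)) 1, q.attachingFraming θ =
      mfderiv 𝓘(ℝ, ℝ) (𝓡∂ 4) (fun s : ℝ => (bBase g).incl (Φ₀.toHomeo
        (θ, (κ * Real.sin s) • reflFibre (-1) (θ : EuclideanSpace ℝ (Fin 2))))) 0 (1 : ℝ)) :
    pageTwisting g A q.attachingFraming = -1 := by
  -- the one-twist fibre framing `ν₂` and Y2's computation of its page twisting
  set ν₂ : sphere (0 : EuclideanSpace ℝ (Fin 2)) 1 → EuclideanSpace ℝ (Fin 4) := fun θ =>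
    mfderiv 𝓘(ℝ, ℝ) (𝓡∂ 4) (fun ε : ℝ => (bBase g).incl (Φ₀.toHomeo
      (θ, ε • reflFibre (-1) (θ : EuclideanSpace ℝ (Fin 2))))) 0 (1 : ℝ) with hν₂
  have hY2 := pageTwisting_core hd hA hAd Φ₀ hκ₀ hr hcore hder false (s := -1) (by norm_num)
  have e1 : (fun θ => A (uDir false θ)) = A := funext fun θ => by rw [uDir_false]
  have e2 : (fun θ : sphere (0 : EuclideanSpace ℝ (Fin 2)) 1 => mfderiv 𝓘(ℝ, ℝ) (𝓡∂ 4)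
      (fun ε : ℝ => (bBase g).incl (Φ₀.toHomeo (uDir false θ,
        ε • reflFibre (-1) (θ : EuclideanSpace ℝ (Fin 2))))) 0 (1 : ℝ)) = ν₂ := by
    funext θ; rw [uDir_false]
  rw [e1, e2] at hY2
  have htw₂ : pageTwisting g A ν₂ = -1 := by
    have h1 : ((pageTwisting g A ν₂ : ℤ) : ℝ) = -1 := by rw [hY2]; simp [slideSign]
    exact_mod_cast h1
  -- the handle framing is `κ • ν₂`
  have hF : q.attachingFraming = fun θ => κ • ν₂ θ := by
    funext θ; rw [hfr θ, mfderiv_blockFraming_eq_smul]; rfl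
  -- the twisting loop of the handle framing never vanishes and is continuous, so `ν₂`'s is too
  have hne : ∀ t, pageTwistingLoop g A q.attachingFraming t ≠ 0 := by
    intro t
    have h := pageTwistingLoop_attachingFraming_ne_zero q hd (by rw [hcirc]; exact hAd) t
    rwa [hcirc] at h
  have hcont : Continuous (pageTwistingLoop g A q.attachingFraming) := by
    have h := continuous_pageTwistingLoop (g := g) (K := q.attachingCircle) (ν := q.attachingFraming)
      ((isSmoothEmbedding_attachingCircle q).contMDiff.of_le (by simp))
      (isKnotFraming_attachingFraming q).continuous
    rwa [hcirc] at h
  have hloopeq : pageTwistingLoop g A ν₂ = fun t => (κ⁻¹ : ℝ) * pageTwistingLoop g A q.attachingFraming t := by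
    funext t
    rw [hF, pageTwistingLoop_smul, ← mul_assoc]
    push_cast
    rw [inv_mul_cancel₀ (by exact_mod_cast hκ), one_mul]
  have hloop : IsNonvanishingLoop (pageTwistingLoop g A ν₂) := by
    rw [hloopeq]
    exact ⟨(continuous_const.mul hcont).continuousOn,
      fun t _ => mul_ne_zero (by exact_mod_cast inv_ne_zero hκ) (hne t),
      by simp only [pageTwistingLoop_zero_eq_one]⟩
  rw [hF, pageTwisting_smul hκ hloop, htw₂]

/-! ## §4 Assembly: the block attaching map along an embedded page curve -/

/-- **The block attaching map along a smoothly embedded page curve** (`exists_blockMap`).  For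
`‖d‖ = 1`, a smooth embedding `A : 𝕊¹ → Base g` into `page g d` and an open `U ⊇ A(𝕊¹)` there is an
attaching map `qA` of a 2-handle on `Base g` with range in `U`, attaching circle `A`, PAGE TWISTING `−1`,
which is the once-twisted standard tube map of a globally smooth tube `Φ` around `A`, injective on
`𝕊¹ × B(0, 2κ)` and FIBRED there (`Φ (x, v) ∈ page g (d · e^{iσ v₁})`): clauses `qA_circle`,
`qA_twist`, `qA_tube` of `StabBaseData` (sign `s = true`).  Z4's page tube + H6-3's tube map + §1–§3.
[cite: EtnyreFuller2006, §2] -/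
theorem exists_blockMap {d : ℂ} (hd : ‖d‖ = 1) {A : sphere (0 : EuclideanSpace ℝ (Fin 2)) 1 → Base g}
    (hA : Manifold.IsSmoothEmbedding (𝓡 1) (𝓡∂ 4) ∞ A) (hAd : ∀ θ, A θ ∈ page g d)
    {U : Set (Base g)} (hU : IsOpen U) (hAU : range A ⊆ U) :
    ∃ qA : HandleAttachingMap 3 2 (Base g), range qA.toFun ⊆ U ∧ qA.attachingCircle = A ∧
      pageTwisting g A qA.attachingFraming = -1 ∧
      ∃ (Φ : sphere (0 : EuclideanSpace ℝ (Fin 2)) 1 × EuclideanSpace ℝ (Fin 2) → Base g)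
        (κ σ : ℝ) (s : Bool), 0 < κ ∧ σ ≠ 0 ∧
      ContMDiff ((𝓡 1).prod (𝓡 2)) (𝓡∂ 4) ∞ Φ ∧ InjOn Φ (univ ×ˢ Metric.ball 0 (2 * κ)) ∧
      (∀ x, Φ (x, 0) = A x) ∧
      (∀ x v, ‖v‖ < 2 * κ → Φ (x, v) ∈ page g (d * Complex.exp ((σ * v 1 : ℝ) * Complex.I))) ∧
      (∀ (x : sphere (0 : EuclideanSpace ℝ (Fin 2)) 1) (v : EuclideanSpace ℝ (Fin 2)) (_ : ‖v‖ < 1)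
        (y : ↥(handleTube 3 2)),
        (y.1.1 : EuclideanSpace ℝ (Fin 4)) =
          WithLp.toLp 2 ![Real.sqrt (1 - ‖v‖ ^ 2) * x.1 0, Real.sqrt (1 - ‖v‖ ^ 2) * x.1 1, v 0, v 1] →
        qA.toFun y = Φ (x, κ • WithLp.toLp 2 ![x.1 0 * v 0 + (if s then 1 else -1) * x.1 1 * v 1,
          x.1 0 * v 1 - (if s then 1 else -1) * x.1 1 * v 0])) := by
  -- Z4's page tube around `A`
  obtain ⟨κ₀, r, R, θR, Φ₀, hκ₀, hr, -, -, -, -, -, -, -, -, hcore, hpages, -, hder⟩ :=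
    helper_exists_pageTube g d A hd hA hAd
  -- the once-twisted standard tube map of `Φ₀` inside `U` (H6-3)
  have hKU : ∀ θ, (bBase g).incl (Φ₀.core θ) ∈ U := fun θ => by rw [hcore θ]; exact hAU ⟨θ, rfl⟩
  obtain ⟨q, κ, hκ, hκ4, hrange, hcirc, hfr, htube⟩ := exists_blockMap_of_tube Φ₀ hU hKU
  have hcircA : q.attachingCircle = A := funext fun θ => (hcirc θ).trans (hcore θ)
  -- the globally smooth tube
  obtain ⟨Φ, hΦs, hΦi, hΦeq⟩ := exists_global_tube Φ₀
  refine ⟨q, hrange, hcircA, pageTwisting_blockMap_eq_neg_one hd hA hAd Φ₀ hκ₀ hr hcore hder q hκ.ne'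
    hcircA hfr, Φ, κ, κ₀, true, hκ, hκ₀.ne', hΦs, ?_, fun x => ?_, fun x v hv => ?_, fun x v hv y hy => ?_⟩
  · exact hΦi.mono (prod_mono le_rfl (ball_subset_ball (by linarith)))
  · rw [hΦeq x 0 (by simp), ← hcore x, CircleTube.core_apply]
  · have hv2 : ‖v‖ ≤ 1 / 2 := by linarith
    rw [hΦeq x v hv2]
    have h := hpages x v (by linarith)
    convert h using 2
    push_cast
    ring_nf
  · -- the norm of the once-twisted fibre is that of the fibre
    have hn : ‖fibreRot (-1) (x : EuclideanSpace ℝ (Fin 2)) v‖ = ‖v‖ := by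
      have h2 : ‖fibreRot (-1) (x : EuclideanSpace ℝ (Fin 2)) v‖ ^ 2 = ‖v‖ ^ 2 := by
        have hx : (x : EuclideanSpace ℝ (Fin 2)) 0 ^ 2 + (x : EuclideanSpace ℝ (Fin 2)) 1 ^ 2 = 1 := by
          have h3 : ‖(x : EuclideanSpace ℝ (Fin 2))‖ ^ 2 = 1 := by rw [norm_eq_of_mem_sphere x, one_pow]
          rwa [EuclideanSpace.real_norm_sq_eq, Fin.sum_univ_two] at h3
        rw [EuclideanSpace.real_norm_sq_eq, EuclideanSpace.real_norm_sq_eq, Fin.sum_univ_two,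
          Fin.sum_univ_two, fibreRot_apply_zero, fibreRot_apply_one]
        linear_combination (v 0 ^ 2 + v 1 ^ 2) * hx
      nlinarith [norm_nonneg (fibreRot (-1) (x : EuclideanSpace ℝ (Fin 2)) v), norm_nonneg v]
    rw [htube x v hv y hy]
    split_ifs with hs
    · simp only [one_mul]
      rw [hΦeq]
      rw [norm_smul, Real.norm_eq_abs, abs_of_pos hκ, ← fibreRot_neg_one_eq, hn]
      nlinarith
    · exact (hs rfl).elim

end StabBlockMap

/-! ## Registered helper -/

/-- **Registered helper `helper_exists_blockMap` (sub-goal of `stub_STgeo` ▸ N3-nat ▸ N3d-1 ▸ N3c, wave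
7, lead c5): the Lefschetz attaching map along a smoothly embedded page curve — range in any prescribed
neighbourhood, attaching circle the curve, page twisting `−1`, and the once-twisted standard tube map of
a globally smooth fibred tube (clauses `qA_circle`, `qA_twist`, `qA_tube` of `StabBaseData`).**
[cite: EtnyreFuller2006, §2] -/
theorem helper_exists_blockMap : ∀ (g : ℕ) (d : ℂ) (A : Metric.sphere (0 : EuclideanSpace ℝ (Fin 2)) 1 → Literature.Topology.FourManifolds.LefschetzBase.Base g), ‖d‖ = 1 → Manifold.IsSmoothEmbedding (𝓡 1) (𝓡∂ 4) ∞ A → (∀ θ, A θ ∈ Literature.Topology.FourManifolds.LefschetzBase.page g d) → ∀ (U : Set (Literature.Topology.FourManifolds.LefschetzBase.Base g)), IsOpen U → Set.range A ⊆ U → ∃ qA : Literature.Topology.FourManifolds.HandleAttachingMap 3 2 (Literature.Topology.FourManifolds.LefschetzBase.Base g), Set.range qA.toFun ⊆ U ∧ qA.attachingCircle = A ∧ Literature.Topology.FourManifolds.LefschetzBase.pageTwisting g A qA.attachingFraming = -1 ∧ ∃ (Φ : Metric.sphere (0 : EuclideanSpace ℝ (Fin 2)) 1 × EuclideanSpace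 ℝ (Fin 2) → Literature.Topology.FourManifolds.LefschetzBase.Base g) (κ σ : ℝ) (s : Bool), 0 < κ ∧ σ ≠ 0 ∧ ContMDiff ((𝓡 1).prod (𝓡 2)) (𝓡∂ 4) ∞ Φ ∧ Set.InjOn Φ (Set.univ ×ˢ Metric.ball 0 (2 * κ)) ∧ (∀ x, Φ (x, 0) = A x) ∧ (∀ x v, ‖v‖ < 2 * κ → Φ (x, v) ∈ Literature.Topology.FourManifolds.LefschetzBase.page g (d * Complex.exp ((σ * v 1 : ℝ) * Complex.I))) ∧ (∀ (x : Metric.sphere (0 : EuclideanSpace ℝ (Fin 2)) 1) (v : EuclideanSpace ℝ (Fin 2)) (_ : ‖v‖ < 1) (y : ↥(Literature.Topology.FourManifolds.handleTube 3 2)), (y.1.1 : EuclideanSpace ℝ (Fin 4)) = WithLp.toLp 2 ![Real.sqrt (1 - ‖v‖ ^ 2) * x.1 0, Real.sqrt (1 - ‖v‖ ^ 2) * x.1 1, v 0, v 1] → qA.toFun y = Φ (x, κ • WithLp.toLp 2 ![x.1 0 * v 0 + (if s then 1 else -1) * x.1 1 * v 1, x.1 0 * v 1 - (if s then 1 else -1)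 * x.1 1 * v 0])) :=
  fun _ _ _ hd hA hAd _ hU hAU => StabBlockMap.exists_blockMap hd hA hAd hU hAU

end Summit.SmoothPoincare4.SmoothPoincare4.Theorems.AcyclicBisectionExists.ModpBraidOrbits

end
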